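import Summits.CriticalPhenomena.Ising3DConformalLimit.Theses.ThresholdDilation
import Literature.Probability.LatticeModels.AxisSpectralRepresentationProofs
import Literature.Probability.LatticeModels.CriticalTwoPointBounds
import Literature.Probability.LatticeModels.CriticalTwoPointLower

/-!
# Route ThresholdDilation — support `AxisKallenLehmann` (item stmt-CriticalPhenomena-6328)

The axis Källén–Lehmann (Hausdorff-moment) representation of the critical two-point function of
the nearest-neighbour Ising model on `ℤ³`: there is a finite positive measure `ν` carried by
`[0, 1]` with `⟨σ₀ σ_{n e₀}⟩⁺_{β_c(3)} = ∫ λⁿ dν(λ)` for every `n ≥ 0`.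

Proof: this is the Hausdorff-moment corollary
`Literature.Probability.LatticeModels.AizenmanDuminilCopin2021_prop_8_6.criticalAxis` (change of
variables `λ = e^{-a}` in Aizenman–Duminil-Copin 2021, Prop. 8.6 = Prop. 5.3, the spectral
representation along a principal axis) at `d = 3`, `i = 0`, with its three inputs discharged in the
tree: the spectral representation itself (`AizenmanDuminilCopin2021_prop_8_6_holds`, transfer
matrix on tori + weak limits), `m*(β_c) = 0` for `d ≥ 3`
(`spontaneousMagnetization_criticalBeta_eq_zero_holds`, Aizenman–Duminil-Copin–Sidoravicius 2015)
and `β_c > 0` (`criticalBeta_pos_holds`).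
-/

namespace Summit.CriticalPhenomena.Ising3DConformalLimit.Theorems

open Literature.Probability.LatticeModels

/-- **Item `AxisKallenLehmann` (stmt-CriticalPhenomena-6328) of route ThresholdDilation, proved.**
The critical axis two-point function `n ↦ ⟨σ₀ σ_{n e₀}⟩⁺_{β_c(3)}` of the three-dimensional
nearest-neighbour Ising model is a Hausdorff moment sequence: `= ∫ tⁿ dν` for a finite positive
measure `ν` on `ℝ` with `ν ([0,1]ᶜ) = 0`. From Aizenman–Duminil-Copin 2021 Prop. 8.6 (proved in
the tree as `AizenmanDuminilCopin2021_prop_8_6_holds`) via its corollary `….criticalAxis`, fed with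
`spontaneousMagnetization_criticalBeta_eq_zero_holds` and `criticalBeta_pos_holds`. -/
theorem axisKallenLehmann_proof :
    Summit.CriticalPhenomena.Ising3DConformalLimit.Theses.ThresholdDilation.AxisKallenLehmann := by
  unfold Summit.CriticalPhenomena.Ising3DConformalLimit.Theses.ThresholdDilation.AxisKallenLehmann
  exact AizenmanDuminilCopin2021_prop_8_6_holds.criticalAxis (d' := 2) (by norm_num)
    spontaneousMagnetization_criticalBeta_eq_zero_holds criticalBeta_pos_holds 0

end Summit.CriticalPhenomena.Ising3DConformalLimit.Theorems
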